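import Summits.AtomisticToContinuum.Crystallization.Theorems.ChargedEnergyGapChartDialL

/-!
# `ChargedEnergyGap` · the CHART DIAL, part M: CAP OR SQUARE, and the two estimates of the square lemma
(decomp-a2c lens-3 g39 node «ChargeFreeGap»; pattern / algebra half — no configuration `Q` appears)

§1 CAP OR SQUARE (proved): for every `d ∈ ℝ³` and either kissing pattern `P`, EITHER some `w ∈ P` is within
   `arccos (79/100) ≈ 37·8°` of `d` (`79/100·‖d‖ ≤ ⟪d, w⟫`), OR `d` is within `arccos (39/40) ≈ 12·8°` of the unit
   normal `s/√2` of a SQUARE FACE of `P`: `IsPatternSquare P w₁ w₂ w₃ w₄ s` — four pattern vectors, cyclically consecutive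
   ones at distance `1`, `w₁ + w₃ = w₂ + w₄ = s`, `‖s‖² = 2` — with `39/40·√2·‖d‖ ≤ ⟪d, s⟫` (`exists_cap_or_square`;
   the twelve squares — six of the cuboctahedron, three upper and three mirrored lower ones of the anticuboctahedron —
   are kernel-decided integer data, `isPatternSquare_fcc` / `isPatternSquare_hcp`, on top of part L §2).
§2 THE TWO ESTIMATES (pure inner-product algebra; frame units `nn(p) = 1`; intruder `d`, `1 ≤ ‖d‖ ≤ 6/5`; frame
   points `t` of bond neighbours, `1 ≤ ‖t‖ ≤ 101/100`; NON-EXCLUSION `‖t‖ ≤ (101/100)·‖t − d‖`, i.e. the intruder is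
   not inside the nearest-neighbour ball of that bond neighbour, giving `⟪t, d⟫ ≤ ‖d‖²/2 + 1/80`):
   * `cap_case_false`: no frame point within `3/20` of a vector `w` with `79/100·‖d‖ ≤ ⟪d, w⟫` obeys non-exclusion
     (`⟪t, d⟫ ≥ 0·64·‖d‖ > ‖d‖²/2 + 1/80` on `[1, 6/5]`);
   * `square_case_false`: four frame points `tᵢ` within `3/20` of the vertices `yᵢ` of a square face whose normal is
     within `12·8°` of `d`, consecutive frame distances `≤ (101/100)²` (the four-ring bonds), each obeying
     non-exclusion, are contradictory.  With `B(x, y) = ‖d‖²⟪x, y⟫ − ⟪x, d⟫⟪y, d⟫` (the Gram form of the projection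
     orthogonal to `d`, scaled): consecutive pairs have `B ≥ 0·4796·‖d‖² − (‖d‖²/2 + 1/80)²` (`pair_form_lower`, using
     `⟪tᵢ, d⟫ ≥ 0` from `inner_nonneg_of_near_vertex`), the four sum to `B(t₁ + t₃, t₂ + t₄) ≤ ‖ ‖d‖(Σ tᵢ) − 2√2 d ‖²/4`
     (polarisation, `four_mul_form_le`), and `‖ ‖d‖(Σ tᵢ) − 2√2 d ‖ ≤ (31/25)‖d‖` (`norm_quad_sub_le`: the diagonal
     sum `S` has `‖ ‖d‖ S − √2 d ‖ ≤ (8/25)‖d‖`, `norm_diag_sub_le`, plus `4θ‖d‖`).  The numbers: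
     `16·(0·4796 x − (x/2 + 1/80)²) > (31/25)² x` on `x = ‖d‖² ∈ [1, 36/25]`.

No `sorry`, no new axiom, no instance / notation / option.  New `Prop`: `IsPatternSquare` (square data, a conjunction).
-/

noncomputable section

open Literature.MathematicalPhysics.StatisticalMechanics
open Literature.Geometry.DiscreteGeometry
open Summit.AtomisticToContinuum.Crystallization.Theses.PricedLinkCensus
open Summit.AtomisticToContinuum.Crystallization.Theorems.ChargedEnergyGapNegative
open RealInnerProductSpace
namespace Summit.AtomisticToContinuum.Crystallization.Theorems.ChargedEnergyGapChartDial

/-! ## §1 Cap or square -/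

section squares

/-- **Square data** `IsPatternSquare P w₁ w₂ w₃ w₄ s`: four points of `P`, cyclically consecutive ones at distance `1`, the two
diagonals with the same sum `s`, `‖s‖² = 2` (a square face of side `1` of the (anti)cuboctahedron; `s/√2` = its unit
normal, at `45°` from each vertex). -/
def IsPatternSquare (P : Finset E3) (w₁ w₂ w₃ w₄ s : E3) : Prop :=
  w₁ ∈ P ∧ w₂ ∈ P ∧ w₃ ∈ P ∧ w₄ ∈ P ∧ w₁ + w₃ = s ∧ w₂ + w₄ = s ∧
    dist w₁ w₂ = 1 ∧ dist w₂ w₃ = 1 ∧ dist w₃ w₄ = 1 ∧ dist w₄ w₁ = 1 ∧ ‖s‖ ^ 2 = 2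

/-- Squares are transported by linear isometries. -/
theorem IsPatternSquare.image {P : Finset E3} {w₁ w₂ w₃ w₄ s : E3} (h : IsPatternSquare P w₁ w₂ w₃ w₄ s) (A : E3 →ₗᵢ[ℝ] E3) :
    IsPatternSquare (P.image A) (A w₁) (A w₂) (A w₃) (A w₄) (A s) := by
  classical
  obtain ⟨h1, h2, h3, h4, h13, h24, d12, d23, d34, d41, hs⟩ := h
  refine ⟨Finset.mem_image_of_mem _ h1, Finset.mem_image_of_mem _ h2, Finset.mem_image_of_mem _ h3,
    Finset.mem_image_of_mem _ h4, by rw [← map_add, h13], by rw [← map_add, h24], ?_, ?_, ?_, ?_, by rw [A.norm_map, hs]⟩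
    <;> rw [A.isometry.dist_eq] <;> assumption

/-- A square of a scaled integer pattern from integer data. -/
theorem isPatternSquare_of_int {S : Finset (Fin 3 → ℤ)} {N : ℕ} (hN : N ≠ 0) {v₁ v₂ v₃ v₄ k : Fin 3 → ℤ}
    (h₁ : v₁ ∈ S) (h₂ : v₂ ∈ S) (h₃ : v₃ ∈ S) (h₄ : v₄ ∈ S) (h13 : v₁ + v₃ = k) (h24 : v₂ + v₄ = k)
    (d12 : sqNormInt (v₁ - v₂) = N) (d23 : sqNormInt (v₂ - v₃) = N) (d34 : sqNormInt (v₃ - v₄) = N)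
    (d41 : sqNormInt (v₄ - v₁) = N) (hk : sqNormInt k = 2 * (N : ℤ)) :
    IsPatternSquare (scaledPattern S N) ((Real.sqrt N)⁻¹ • intVec v₁) ((Real.sqrt N)⁻¹ • intVec v₂)
      ((Real.sqrt N)⁻¹ • intVec v₃) ((Real.sqrt N)⁻¹ • intVec v₄) ((Real.sqrt N)⁻¹ • intVec k) := by
  have hpos : (0 : ℝ) < Real.sqrt N := by positivity
  have hN' : (0 : ℝ) < N := by exact_mod_cast Nat.pos_of_ne_zero hN
  refine ⟨Finset.mem_image_of_mem _ h₁, Finset.mem_image_of_mem _ h₂, Finset.mem_image_of_mem _ h₃,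
    Finset.mem_image_of_mem _ h₄, by rw [← smul_add, ← intVec_add, h13], by rw [← smul_add, ← intVec_add, h24],
    dist_scaled_eq_one hN d12, dist_scaled_eq_one hN d23, dist_scaled_eq_one hN d34, dist_scaled_eq_one hN d41, ?_⟩
  have hk' : (sqNormInt k : ℝ) = 2 * N := by exact_mod_cast hk
  rw [norm_smul, norm_inv, Real.norm_of_nonneg hpos.le, mul_pow, norm_intVec, hk', Real.sq_sqrt (by positivity),
    inv_pow, Real.sq_sqrt hN'.le]
  field_simp

/-- FCC squares from integer data (all hypotheses kernel-decidable). -/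
theorem isPatternSquare_fcc {v₁ v₂ v₃ v₄ k : Fin 3 → ℤ} (h₁ : v₁ ∈ fccInt) (h₂ : v₂ ∈ fccInt) (h₃ : v₃ ∈ fccInt)
    (h₄ : v₄ ∈ fccInt) (h13 : v₁ + v₃ = k) (h24 : v₂ + v₄ = k) (d12 : sqNormInt (v₁ - v₂) = (2 : ℕ))
    (d23 : sqNormInt (v₂ - v₃) = (2 : ℕ)) (d34 : sqNormInt (v₃ - v₄) = (2 : ℕ)) (d41 : sqNormInt (v₄ - v₁) = (2 : ℕ))
    (hk : sqNormInt k = 2 * ((2 : ℕ) : ℤ)) :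
    IsPatternSquare fccKissingPattern ((Real.sqrt 2)⁻¹ • intVec v₁) ((Real.sqrt 2)⁻¹ • intVec v₂)
      ((Real.sqrt 2)⁻¹ • intVec v₃) ((Real.sqrt 2)⁻¹ • intVec v₄) ((Real.sqrt 2)⁻¹ • intVec k) := by
  have h := isPatternSquare_of_int (S := fccInt) (N := 2) (by norm_num) h₁ h₂ h₃ h₄ h13 h24 d12 d23 d34 d41 hk
  rw [show fccKissingPattern = scaledPattern fccInt 2 from rfl]
  simpa using h

/-- HCP squares from integer data. -/
theorem isPatternSquare_hcp {v₁ v₂ v₃ v₄ k : Fin 3 → ℤ} (h₁ : v₁ ∈ hcpInt) (h₂ : v₂ ∈ hcpInt) (h₃ : v₃ ∈ hcpInt)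
    (h₄ : v₄ ∈ hcpInt) (h13 : v₁ + v₃ = k) (h24 : v₂ + v₄ = k) (d12 : sqNormInt (v₁ - v₂) = (18 : ℕ))
    (d23 : sqNormInt (v₂ - v₃) = (18 : ℕ)) (d34 : sqNormInt (v₃ - v₄) = (18 : ℕ))
    (d41 : sqNormInt (v₄ - v₁) = (18 : ℕ)) (hk : sqNormInt k = 2 * ((18 : ℕ) : ℤ)) :
    IsPatternSquare hcpKissingPattern ((Real.sqrt 18)⁻¹ • intVec v₁) ((Real.sqrt 18)⁻¹ • intVec v₂)
      ((Real.sqrt 18)⁻¹ • intVec v₃) ((Real.sqrt 18)⁻¹ • intVec v₄) ((Real.sqrt 18)⁻¹ • intVec k) := by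
  have h := isPatternSquare_of_int (S := hcpInt) (N := 18) (by norm_num) h₁ h₂ h₃ h₄ h13 h24 d12 d23 d34 d41 hk
  rw [show hcpKissingPattern = scaledPattern hcpInt 18 from rfl]
  simpa using h

/-- Comparing `a·√2` with a scaled integer inner product: `a·M ≤ X`, `√2·√N = M` ⟹ `a·√2 ≤ (√N)⁻¹·X`. -/
theorem mul_sqrt_two_le_inv_mul {N M a X : ℝ} (hN : 0 < N) (hM : Real.sqrt 2 * Real.sqrt N = M) (h : a * M ≤ X) :
    a * Real.sqrt 2 ≤ (Real.sqrt N)⁻¹ * X := by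
  rw [le_inv_mul_iff₀ (Real.sqrt_pos.2 hN)]
  calc Real.sqrt N * (a * Real.sqrt 2) = a * M := by rw [← hM]; ring
    _ ≤ X := h

/-- **CAP OR SQUARE**: for every `d ∈ ℝ³` and either kissing pattern `P`, EITHER some `w ∈ P` has
`⟪d, w⟫ ≥ (79/100)·‖d‖` (within `≈ 37·8°` of `d`), OR `d` is within `≈ 12·8°` of the unit normal `s/√2` of a square
face of `P`: `IsPatternSquare P w₁ w₂ w₃ w₄ s` with `⟪d, s⟫ ≥ (39/40)·√2·‖d‖`. -/
theorem exists_cap_or_square {P : Finset E3} (hP : P = fccKissingPattern ∨ P = hcpKissingPattern) (d : E3) :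
    (∃ w ∈ P, 79 / 100 * ‖d‖ ≤ ⟪d, w⟫) ∨
    (∃ w₁ w₂ w₃ w₄ s : E3, IsPatternSquare P w₁ w₂ w₃ w₄ s ∧ 39 / 40 * Real.sqrt 2 * ‖d‖ ≤ ⟪d, s⟫) := by
  have hn := norm_nonneg d
  have hs0 : 0 < Real.sqrt 2 := by positivity
  rcases hP with rfl | rfl
  · rcases exists_fccInt_inner_ge_or_coord d with ⟨v, hv, h⟩ | ⟨k, hk⟩
    · refine Or.inl ⟨_, Finset.mem_image_of_mem _ hv, ?_⟩
      rw [Nat.cast_ofNat, real_inner_smul_right, le_inv_mul_iff₀ hs0]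
      nlinarith [mul_le_mul_of_nonneg_right sqrt_two_le hn]
    · right
      have hk' : 39 / 40 * ‖d‖ ≤ |d 0| ∨ 39 / 40 * ‖d‖ ≤ |d 1| ∨ 39 / 40 * ‖d‖ ≤ |d 2| := by
        fin_cases k
        exacts [Or.inl hk, Or.inr (Or.inl hk), Or.inr (Or.inr hk)]
      rcases hk' with h | h | h
      · rcases le_or_gt 0 (d 0) with h0 | h0
        · rw [abs_of_nonneg h0] at h
          refine ⟨_, _, _, _, _, isPatternSquare_fcc (v₁ := ![1, 1, 0]) (v₂ := ![1, 0, 1]) (v₃ := ![1, -1, 0])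
            (v₄ := ![1, 0, -1]) (k := ![2, 0, 0]) (by decide) (by decide) (by decide) (by decide) (by decide)
            (by decide) (by decide) (by decide) (by decide) (by decide) (by decide), ?_⟩
          rw [mul_right_comm, real_inner_smul_right, inner_intVec_coord]
          exact mul_sqrt_two_le_inv_mul two_pos sqrt_two_mul_sqrt_two (by simp; linarith)
        · rw [abs_of_neg h0] at h
          refine ⟨_, _, _, _, _, isPatternSquare_fcc (v₁ := ![-1, 1, 0]) (v₂ := ![-1, 0, 1]) (v₃ := ![-1, -1, 0])
            (v₄ := ![-1, 0, -1]) (k := ![-2, 0, 0]) (by decide) (by decide) (by decide) (by decide) (by decide)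
            (by decide) (by decide) (by decide) (by decide) (by decide) (by decide), ?_⟩
          rw [mul_right_comm, real_inner_smul_right, inner_intVec_coord]
          exact mul_sqrt_two_le_inv_mul two_pos sqrt_two_mul_sqrt_two (by simp; linarith)
      · rcases le_or_gt 0 (d 1) with h0 | h0
        · rw [abs_of_nonneg h0] at h
          refine ⟨_, _, _, _, _, isPatternSquare_fcc (v₁ := ![1, 1, 0]) (v₂ := ![0, 1, 1]) (v₃ := ![-1, 1, 0])
            (v₄ := ![0, 1, -1]) (k := ![0, 2, 0]) (by decide) (by decide) (by decide) (by decide) (by decide)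
            (by decide) (by decide) (by decide) (by decide) (by decide) (by decide), ?_⟩
          rw [mul_right_comm, real_inner_smul_right, inner_intVec_coord]
          exact mul_sqrt_two_le_inv_mul two_pos sqrt_two_mul_sqrt_two (by simp; linarith)
        · rw [abs_of_neg h0] at h
          refine ⟨_, _, _, _, _, isPatternSquare_fcc (v₁ := ![1, -1, 0]) (v₂ := ![0, -1, 1]) (v₃ := ![-1, -1, 0])
            (v₄ := ![0, -1, -1]) (k := ![0, -2, 0]) (by decide) (by decide) (by decide) (by decide) (by decide)
            (by decide) (by decide) (by decide) (by decide) (by decide) (by decide), ?_⟩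
          rw [mul_right_comm, real_inner_smul_right, inner_intVec_coord]
          exact mul_sqrt_two_le_inv_mul two_pos sqrt_two_mul_sqrt_two (by simp; linarith)
      · rcases le_or_gt 0 (d 2) with h0 | h0
        · rw [abs_of_nonneg h0] at h
          refine ⟨_, _, _, _, _, isPatternSquare_fcc (v₁ := ![1, 0, 1]) (v₂ := ![0, 1, 1]) (v₃ := ![-1, 0, 1])
            (v₄ := ![0, -1, 1]) (k := ![0, 0, 2]) (by decide) (by decide) (by decide) (by decide) (by decide)
            (by decide) (by decide) (by decide) (by decide) (by decide) (by decide), ?_⟩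
          rw [mul_right_comm, real_inner_smul_right, inner_intVec_coord]
          exact mul_sqrt_two_le_inv_mul two_pos sqrt_two_mul_sqrt_two (by simp; linarith)
        · rw [abs_of_neg h0] at h
          refine ⟨_, _, _, _, _, isPatternSquare_fcc (v₁ := ![1, 0, -1]) (v₂ := ![0, 1, -1]) (v₃ := ![-1, 0, -1])
            (v₄ := ![0, -1, -1]) (k := ![0, 0, -2]) (by decide) (by decide) (by decide) (by decide) (by decide)
            (by decide) (by decide) (by decide) (by decide) (by decide) (by decide), ?_⟩
          rw [mul_right_comm, real_inner_smul_right, inner_intVec_coord]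
          exact mul_sqrt_two_le_inv_mul two_pos sqrt_two_mul_sqrt_two (by simp; linarith)
  · have h18 : (0 : ℝ) < 18 := by norm_num
    have hs18 : 0 < Real.sqrt 18 := by positivity
    rcases exists_hcpInt_inner_ge_or_coord d with ⟨v, hv, h⟩ | ⟨k, hk, hs⟩ | ⟨k, hk, hs⟩
    · refine Or.inl ⟨_, Finset.mem_image_of_mem _ hv, ?_⟩
      rw [Nat.cast_ofNat, real_inner_smul_right, le_inv_mul_iff₀ hs18]
      nlinarith [mul_le_mul_of_nonneg_right sqrt_eighteen_le hn]
    · right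
      have hk' : 39 / 40 * ‖d‖ ≤ d 0 ∨ 39 / 40 * ‖d‖ ≤ d 1 ∨ 39 / 40 * ‖d‖ ≤ d 2 := by
        fin_cases k
        exacts [Or.inl hk, Or.inr (Or.inl hk), Or.inr (Or.inr hk)]
      rcases hk' with h | h | h
      · refine ⟨_, _, _, _, _, isPatternSquare_hcp (v₁ := ![3, 3, 0]) (v₂ := ![3, 0, 3]) (v₃ := ![3, -3, 0])
          (v₄ := ![3, 0, -3]) (k := ![6, 0, 0]) (by decide) (by decide) (by decide) (by decide) (by decide)
          (by decide) (by decide) (by decide) (by decide) (by decide) (by decide), ?_⟩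
        rw [mul_right_comm, real_inner_smul_right, inner_intVec_coord]
        exact mul_sqrt_two_le_inv_mul h18 sqrt_two_mul_sqrt_eighteen (by simp; linarith)
      · refine ⟨_, _, _, _, _, isPatternSquare_hcp (v₁ := ![3, 3, 0]) (v₂ := ![0, 3, 3]) (v₃ := ![-3, 3, 0])
          (v₄ := ![0, 3, -3]) (k := ![0, 6, 0]) (by decide) (by decide) (by decide) (by decide) (by decide)
          (by decide) (by decide) (by decide) (by decide) (by decide) (by decide), ?_⟩
        rw [mul_right_comm, real_inner_smul_right, inner_intVec_coord]
        exact mul_sqrt_two_le_inv_mul h18 sqrt_two_mul_sqrt_eighteen (by simp; linarith)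
      · refine ⟨_, _, _, _, _, isPatternSquare_hcp (v₁ := ![3, 0, 3]) (v₂ := ![0, 3, 3]) (v₃ := ![-3, 0, 3])
          (v₄ := ![0, -3, 3]) (k := ![0, 0, 6]) (by decide) (by decide) (by decide) (by decide) (by decide)
          (by decide) (by decide) (by decide) (by decide) (by decide) (by decide), ?_⟩
        rw [mul_right_comm, real_inner_smul_right, inner_intVec_coord]
        exact mul_sqrt_two_le_inv_mul h18 sqrt_two_mul_sqrt_eighteen (by simp; linarith)
    · right
      have hk' : 39 / 40 * ‖d‖ ≤ d 0 - 2 / 3 * (d 0 + d 1 + d 2) ∨ 39 / 40 * ‖d‖ ≤ d 1 - 2 / 3 * (d 0 + d 1 + d 2) ∨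
          39 / 40 * ‖d‖ ≤ d 2 - 2 / 3 * (d 0 + d 1 + d 2) := by
        fin_cases k
        exacts [Or.inl hk, Or.inr (Or.inl hk), Or.inr (Or.inr hk)]
      rcases hk' with h | h | h
      · refine ⟨_, _, _, _, _, isPatternSquare_hcp (v₁ := ![-1, -1, -4]) (v₂ := ![-1, -4, -1]) (v₃ := ![3, -3, 0])
          (v₄ := ![3, 0, -3]) (k := ![2, -4, -4]) (by decide) (by decide) (by decide) (by decide) (by decide)
          (by decide) (by decide) (by decide) (by decide) (by decide) (by decide), ?_⟩
        rw [mul_right_comm, real_inner_smul_right, inner_intVec_coord]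
        exact mul_sqrt_two_le_inv_mul h18 sqrt_two_mul_sqrt_eighteen (by simp; linarith)
      · refine ⟨_, _, _, _, _, isPatternSquare_hcp (v₁ := ![-1, -1, -4]) (v₂ := ![-4, -1, -1]) (v₃ := ![-3, 3, 0])
          (v₄ := ![0, 3, -3]) (k := ![-4, 2, -4]) (by decide) (by decide) (by decide) (by decide) (by decide)
          (by decide) (by decide) (by decide) (by decide) (by decide) (by decide), ?_⟩
        rw [mul_right_comm, real_inner_smul_right, inner_intVec_coord]
        exact mul_sqrt_two_le_inv_mul h18 sqrt_two_mul_sqrt_eighteen (by simp; linarith)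
      · refine ⟨_, _, _, _, _, isPatternSquare_hcp (v₁ := ![-1, -4, -1]) (v₂ := ![-4, -1, -1]) (v₃ := ![-3, 0, 3])
          (v₄ := ![0, -3, 3]) (k := ![-4, -4, 2]) (by decide) (by decide) (by decide) (by decide) (by decide)
          (by decide) (by decide) (by decide) (by decide) (by decide) (by decide), ?_⟩
        rw [mul_right_comm, real_inner_smul_right, inner_intVec_coord]
        exact mul_sqrt_two_le_inv_mul h18 sqrt_two_mul_sqrt_eighteen (by simp; linarith)

end squares

/-! ## §2 The two estimates (pure inner-product algebra in `ℝ³`) -/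

section estimates

/-- NON-EXCLUSION in inner-product form: a frame point `t` with `‖t‖ ≤ 101/100` and `‖t‖ ≤ (101/100)·‖t − d‖` has
`⟪t, d⟫ ≤ ‖d‖²/2 + 1/80`. -/
theorem inner_le_of_nonExclusion {t d : E3} (ht : ‖t‖ ≤ 101 / 100) (h : ‖t‖ ≤ 101 / 100 * dist t d) :
    ⟪t, d⟫ ≤ ‖d‖ ^ 2 / 2 + 1 / 80 := by
  have h2 : ‖t‖ ^ 2 ≤ (101 / 100) ^ 2 * (‖t‖ ^ 2 - 2 * ⟪t, d⟫ + ‖d‖ ^ 2) := by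
    have := pow_le_pow_left₀ (norm_nonneg t) h 2
    rw [mul_pow, dist_eq_norm, norm_sub_sq_real] at this
    exact this
  nlinarith [norm_nonneg t]

/-- **CAP CASE**: a frame point `t` (`‖t‖ ≤ 101/100`) that is `θ`-close (`θ ≤ 3/20`) to a vector `w` with
`⟪d, w⟫ ≥ (79/100)·‖d‖` cannot obey non-exclusion against an intruder `d` with `1 ≤ ‖d‖ ≤ 6/5`. -/
theorem cap_case_false {θ : ℝ} (hθ : θ ≤ 3 / 20) {d w t : E3} (hd1 : 1 ≤ ‖d‖) (hd2 : ‖d‖ ≤ 6 / 5)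
    (hw : 79 / 100 * ‖d‖ ≤ ⟪d, w⟫) (htw : dist t w ≤ θ) (ht2 : ‖t‖ ≤ 101 / 100)
    (hex : ‖t‖ ≤ 101 / 100 * dist t d) : False := by
  have hκ := inner_le_of_nonExclusion ht2 hex
  have h1 : 64 / 100 * ‖d‖ ≤ ⟪t, d⟫ := by
    have hsub : |⟪t - w, d⟫| ≤ ‖t - w‖ * ‖d‖ := abs_real_inner_le_norm _ _
    have htw' : ‖t - w‖ ≤ 3 / 20 := by rw [← dist_eq_norm]; exact htw.trans hθ
    rw [inner_sub_left] at hsub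
    have := (abs_le.1 hsub).1
    rw [real_inner_comm] at hw
    nlinarith [mul_le_mul_of_nonneg_right htw' (norm_nonneg d), norm_nonneg d]
  nlinarith [mul_nonneg (sub_nonneg.2 hd1) (sub_nonneg.2 hd2)]

/-- Square case, step 1: the diagonal sum `S` of the square is close to `√2·d/‖d‖`. -/
theorem norm_diag_sub_le {d S : E3} (hd1 : 1 ≤ ‖d‖) (hS : ‖S‖ ^ 2 = 2)
    (hdS : 39 / 40 * Real.sqrt 2 * ‖d‖ ≤ ⟪d, S⟫) : ‖‖d‖ • S - Real.sqrt 2 • d‖ ≤ 8 / 25 * ‖d‖ := by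
  have hr0 : 0 < ‖d‖ := by linarith
  have hs0 : 0 < Real.sqrt 2 := by positivity
  have hs2 : Real.sqrt 2 ^ 2 = 2 := Real.sq_sqrt (by norm_num)
  have hv2 : ‖‖d‖ • S - Real.sqrt 2 • d‖ ^ 2 ≤ ‖d‖ ^ 2 / 10 := by
    have e : ‖‖d‖ • S - Real.sqrt 2 • d‖ ^ 2 =
        ‖d‖ ^ 2 * ‖S‖ ^ 2 - 2 * (‖d‖ * Real.sqrt 2 * ⟪S, d⟫) + Real.sqrt 2 ^ 2 * ‖d‖ ^ 2 := by
      rw [norm_sub_sq_real, norm_smul, norm_smul, real_inner_smul_left, real_inner_smul_right, Real.norm_eq_abs,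
        Real.norm_eq_abs, abs_of_nonneg hs0.le, abs_of_nonneg hr0.le, mul_pow, mul_pow]
      ring
    rw [e, hS, hs2, real_inner_comm]
    have h2r : Real.sqrt 2 * Real.sqrt 2 * ‖d‖ ^ 2 = 2 * ‖d‖ ^ 2 := by rw [← sq, hs2]
    nlinarith [mul_le_mul_of_nonneg_left hdS (mul_nonneg hr0.le hs0.le)]
  nlinarith [norm_nonneg (‖d‖ • S - Real.sqrt 2 • d), mul_pos hr0 hr0]

/-- Square case, step 2: a vertex `y` of the square has `⟪y, S⟫ = 1`. -/
theorem inner_vertex_diag {S y y' : E3} (hS : ‖S‖ ^ 2 = 2) (hy : ‖y‖ = 1) (hy' : ‖y'‖ = 1) (hsum : y + y' = S) :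
    ⟪y, S⟫ = 1 := by
  have h1 : ‖S‖ ^ 2 = ‖y‖ ^ 2 + 2 * ⟪y, y'⟫ + ‖y'‖ ^ 2 := by rw [← hsum]; exact norm_add_sq_real y y'
  rw [hS, hy, hy'] at h1
  rw [← hsum, inner_add_right, real_inner_self_eq_norm_sq, hy]
  linarith

/-- Square case, step 3: a frame point near a vertex of the square has `⟪t, d⟫ ≥ 0`. -/
theorem inner_nonneg_of_near_vertex {θ : ℝ} (hθ : θ ≤ 3 / 20) {d S t y : E3} (hd1 : 1 ≤ ‖d‖)
    (hV : ‖‖d‖ • S - Real.sqrt 2 • d‖ ≤ 8 / 25 * ‖d‖) (hy : ‖y‖ = 1) (hyS : ⟪y, S⟫ = 1) (hty : dist t y ≤ θ) :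
    0 ≤ ⟪t, d⟫ := by
  have hr0 : 0 < ‖d‖ := by linarith
  have hs0 : 0 < Real.sqrt 2 := by positivity
  have h1 : ⟪y, ‖d‖ • S - Real.sqrt 2 • d⟫ ≤ ‖y‖ * ‖‖d‖ • S - Real.sqrt 2 • d‖ := real_inner_le_norm _ _
  rw [hy, one_mul, inner_sub_right, real_inner_smul_right, real_inner_smul_right, hyS, mul_one] at h1
  have h2 : |⟪t - y, d⟫| ≤ ‖t - y‖ * ‖d‖ := abs_real_inner_le_norm _ _
  rw [inner_sub_left] at h2
  have h3 := (abs_le.1 h2).1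
  have hty' : ‖t - y‖ ≤ 3 / 20 := by rw [← dist_eq_norm]; exact hty.trans hθ
  have h4 := mul_le_mul_of_nonneg_right hty' (norm_nonneg d)
  by_contra hc
  push Not at hc
  have hx : ⟪y, d⟫ < 3 / 20 * ‖d‖ := by linarith
  have h5 := mul_lt_mul_of_pos_left hx hs0
  have h6 := mul_le_mul_of_nonneg_right sqrt_two_le hr0.le
  linarith

/-- Square case, step 4: two frame points at frame distance `≤ (101/100)²`, both obeying non-exclusion and with
`⟪t', d⟫ ≥ 0`, keep a definite amount of the quadratic form `B(t, t') = ‖d‖²⟪t, t'⟫ − ⟪t, d⟫⟪t', d⟫`. -/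
theorem pair_form_lower {d t t' : E3} (ht : 1 ≤ ‖t‖) (ht' : 1 ≤ ‖t'‖) (htt' : dist t t' ≤ (101 / 100) ^ 2)
    (k1 : ⟪t, d⟫ ≤ ‖d‖ ^ 2 / 2 + 1 / 80) (k0' : 0 ≤ ⟪t', d⟫)
    (k1' : ⟪t', d⟫ ≤ ‖d‖ ^ 2 / 2 + 1 / 80) :
    4796 / 10000 * ‖d‖ ^ 2 - (‖d‖ ^ 2 / 2 + 1 / 80) ^ 2 ≤ ‖d‖ ^ 2 * ⟪t, t'⟫ - ⟪t, d⟫ * ⟪t', d⟫ := by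
  have h1 : dist t t' ^ 2 = ‖t‖ ^ 2 - 2 * ⟪t, t'⟫ + ‖t'‖ ^ 2 := by rw [dist_eq_norm, norm_sub_sq_real]
  have h2 : dist t t' ^ 2 ≤ ((101 / 100) ^ 2) ^ 2 := pow_le_pow_left₀ dist_nonneg htt' 2
  have h3 : 1 ≤ ‖t‖ ^ 2 := by nlinarith
  have h4 : 1 ≤ ‖t'‖ ^ 2 := by nlinarith
  have h5 : 4796 / 10000 ≤ ⟪t, t'⟫ := by nlinarith
  have h6 : ⟪t, d⟫ * ⟪t', d⟫ ≤ (‖d‖ ^ 2 / 2 + 1 / 80) * (‖d‖ ^ 2 / 2 + 1 / 80) :=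
    mul_le_mul k1 k1' k0' (by positivity)
  nlinarith [mul_le_mul_of_nonneg_left h5 (sq_nonneg ‖d‖)]

/-- Square case, step 5 (polarisation): `4·B(a, b) ≤ ‖ ‖d‖•(a + b) − 2√2•d ‖²`. -/
theorem four_mul_form_le (d a b : E3) :
    4 * (‖d‖ ^ 2 * ⟪a, b⟫ - ⟪a, d⟫ * ⟪b, d⟫) ≤ ‖‖d‖ • (a + b) - (2 * Real.sqrt 2) • d‖ ^ 2 := by
  have hr0 := norm_nonneg d
  have hq0 : 0 ≤ ‖d‖ ^ 2 * ‖a - b‖ ^ 2 - ⟪a - b, d⟫ ^ 2 := by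
    have h := abs_real_inner_le_norm (a - b) d
    have : ⟪a - b, d⟫ ^ 2 ≤ (‖a - b‖ * ‖d‖) ^ 2 := by
      rw [← sq_abs]; exact pow_le_pow_left₀ (abs_nonneg _) h 2
    nlinarith
  have hid : 4 * (‖d‖ ^ 2 * ⟪a, b⟫ - ⟪a, d⟫ * ⟪b, d⟫) =
      (‖d‖ ^ 2 * ‖a + b‖ ^ 2 - ⟪a + b, d⟫ ^ 2) - (‖d‖ ^ 2 * ‖a - b‖ ^ 2 - ⟪a - b, d⟫ ^ 2) := by
    rw [norm_add_sq_real, norm_sub_sq_real, inner_add_left, inner_sub_left]; ring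
  have e : ‖‖d‖ • (a + b) - (2 * Real.sqrt 2) • d‖ ^ 2 =
      ‖d‖ ^ 2 * ‖a + b‖ ^ 2 - 2 * (‖d‖ * (2 * Real.sqrt 2) * ⟪a + b, d⟫) + (2 * Real.sqrt 2) ^ 2 * ‖d‖ ^ 2 := by
    rw [norm_sub_sq_real, norm_smul, norm_smul, real_inner_smul_left, real_inner_smul_right, Real.norm_eq_abs,
      Real.norm_eq_abs, abs_of_nonneg hr0, abs_of_nonneg (by positivity : (0 : ℝ) ≤ 2 * Real.sqrt 2),
      mul_pow, mul_pow]
    ring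
  rw [hid, e]
  nlinarith [sq_nonneg (⟪a + b, d⟫ - 2 * Real.sqrt 2 * ‖d‖)]

/-- Square case, step 6: the diagonal sums of the matched frame quadrilateral are short. -/
theorem norm_quad_sub_le {θ : ℝ} (hθ : θ ≤ 3 / 20) {d S t₁ t₂ t₃ t₄ y₁ y₂ y₃ y₄ : E3}
    (hV : ‖‖d‖ • S - Real.sqrt 2 • d‖ ≤ 8 / 25 * ‖d‖) (h13 : y₁ + y₃ = S) (h24 : y₂ + y₄ = S)
    (e₁ : dist t₁ y₁ ≤ θ) (e₂ : dist t₂ y₂ ≤ θ) (e₃ : dist t₃ y₃ ≤ θ) (e₄ : dist t₄ y₄ ≤ θ) (hd1 : 1 ≤ ‖d‖) :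
    ‖‖d‖ • (t₁ + t₃ + (t₂ + t₄)) - (2 * Real.sqrt 2) • d‖ ≤ 31 / 25 * ‖d‖ := by
  have hr0 : 0 < ‖d‖ := by linarith
  have hdec : ‖d‖ • (t₁ + t₃ + (t₂ + t₄)) - (2 * Real.sqrt 2) • d =
      (2 : ℝ) • (‖d‖ • S - Real.sqrt 2 • d) + ‖d‖ • ((t₁ - y₁) + (t₂ - y₂) + (t₃ - y₃) + (t₄ - y₄)) := by
    have : (t₁ - y₁) + (t₂ - y₂) + (t₃ - y₃) + (t₄ - y₄) = (t₁ + t₃ + (t₂ + t₄)) - (y₁ + y₃) - (y₂ + y₄) := by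
      abel
    rw [this, h13, h24]
    module
  rw [hdec]
  have hE : ‖(t₁ - y₁) + (t₂ - y₂) + (t₃ - y₃) + (t₄ - y₄)‖ ≤ 4 * θ := by
    have a1 := norm_add_le ((t₁ - y₁) + (t₂ - y₂) + (t₃ - y₃)) (t₄ - y₄)
    have a2 := norm_add_le ((t₁ - y₁) + (t₂ - y₂)) (t₃ - y₃)
    have a3 := norm_add_le (t₁ - y₁) (t₂ - y₂)
    rw [← dist_eq_norm t₁ y₁, ← dist_eq_norm t₂ y₂, ← dist_eq_norm t₃ y₃, ← dist_eq_norm t₄ y₄] at *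
    linarith
  calc ‖(2 : ℝ) • (‖d‖ • S - Real.sqrt 2 • d) + ‖d‖ • ((t₁ - y₁) + (t₂ - y₂) + (t₃ - y₃) + (t₄ - y₄))‖
      ≤ ‖(2 : ℝ) • (‖d‖ • S - Real.sqrt 2 • d)‖ + ‖‖d‖ • ((t₁ - y₁) + (t₂ - y₂) + (t₃ - y₃) + (t₄ - y₄))‖ :=
        norm_add_le _ _
    _ = 2 * ‖‖d‖ • S - Real.sqrt 2 • d‖ + ‖d‖ * ‖(t₁ - y₁) + (t₂ - y₂) + (t₃ - y₃) + (t₄ - y₄)‖ := by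
        rw [norm_smul, norm_smul, Real.norm_eq_abs, Real.norm_eq_abs, abs_of_nonneg hr0.le,
          abs_of_nonneg (by norm_num : (0 : ℝ) ≤ 2)]
    _ ≤ 2 * (8 / 25 * ‖d‖) + ‖d‖ * (4 * θ) := by gcongr
    _ ≤ 31 / 25 * ‖d‖ := by nlinarith

/-- **SQUARE CASE**: four frame points `tᵢ` (`1 ≤ ‖tᵢ‖`), `θ`-close (`θ ≤ 3/20`) to the vertices `yᵢ` (unit vectors,
`y₁ + y₃ = y₂ + y₄ = S`, `‖S‖² = 2`) of a square face whose diagonal sum `S` has `⟪d, S⟫ ≥ (39/40)·√2·‖d‖`, with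
cyclically consecutive frame distances `≤ (101/100)²` and each obeying non-exclusion against the intruder `d`
(`1 ≤ ‖d‖ ≤ 6/5`, inner-product form), are contradictory. -/
theorem square_case_false {θ : ℝ} (hθ : θ ≤ 3 / 20) {d S t₁ t₂ t₃ t₄ y₁ y₂ y₃ y₄ : E3}
    (hd1 : 1 ≤ ‖d‖) (hd2 : ‖d‖ ≤ 6 / 5) (hS : ‖S‖ ^ 2 = 2) (hdS : 39 / 40 * Real.sqrt 2 * ‖d‖ ≤ ⟪d, S⟫)
    (hy₁ : ‖y₁‖ = 1) (hy₂ : ‖y₂‖ = 1) (hy₃ : ‖y₃‖ = 1) (hy₄ : ‖y₄‖ = 1) (h13 : y₁ + y₃ = S) (h24 : y₂ + y₄ = S)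
    (e₁ : dist t₁ y₁ ≤ θ) (e₂ : dist t₂ y₂ ≤ θ) (e₃ : dist t₃ y₃ ≤ θ) (e₄ : dist t₄ y₄ ≤ θ)
    (n₁ : 1 ≤ ‖t₁‖) (n₂ : 1 ≤ ‖t₂‖) (n₃ : 1 ≤ ‖t₃‖) (n₄ : 1 ≤ ‖t₄‖)
    (k₁ : ⟪t₁, d⟫ ≤ ‖d‖ ^ 2 / 2 + 1 / 80) (k₂ : ⟪t₂, d⟫ ≤ ‖d‖ ^ 2 / 2 + 1 / 80)
    (k₃ : ⟪t₃, d⟫ ≤ ‖d‖ ^ 2 / 2 + 1 / 80) (k₄ : ⟪t₄, d⟫ ≤ ‖d‖ ^ 2 / 2 + 1 / 80)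
    (c₁₂ : dist t₁ t₂ ≤ (101 / 100) ^ 2) (c₂₃ : dist t₂ t₃ ≤ (101 / 100) ^ 2) (c₃₄ : dist t₃ t₄ ≤ (101 / 100) ^ 2)
    (c₄₁ : dist t₄ t₁ ≤ (101 / 100) ^ 2) : False := by
  have hV := norm_diag_sub_le hd1 hS hdS
  have p₁ := inner_nonneg_of_near_vertex hθ hd1 hV hy₁ (inner_vertex_diag hS hy₁ hy₃ h13) e₁
  have p₂ := inner_nonneg_of_near_vertex hθ hd1 hV hy₂ (inner_vertex_diag hS hy₂ hy₄ h24) e₂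
  have p₃ := inner_nonneg_of_near_vertex hθ hd1 hV hy₃ (inner_vertex_diag hS hy₃ hy₁ (by rw [add_comm]; exact h13)) e₃
  have p₄ := inner_nonneg_of_near_vertex hθ hd1 hV hy₄ (inner_vertex_diag hS hy₄ hy₂ (by rw [add_comm]; exact h24)) e₄
  have hB12 := pair_form_lower n₁ n₂ c₁₂ k₁ p₂ k₂
  have hB23 := pair_form_lower n₂ n₃ c₂₃ k₂ p₃ k₃
  have hB34 := pair_form_lower n₃ n₄ c₃₄ k₃ p₄ k₄
  have hB41 := pair_form_lower n₄ n₁ c₄₁ k₄ p₁ k₁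
  have hsum : ‖d‖ ^ 2 * ⟪t₁ + t₃, t₂ + t₄⟫ - ⟪t₁ + t₃, d⟫ * ⟪t₂ + t₄, d⟫ =
      (‖d‖ ^ 2 * ⟪t₁, t₂⟫ - ⟪t₁, d⟫ * ⟪t₂, d⟫) + (‖d‖ ^ 2 * ⟪t₂, t₃⟫ - ⟪t₂, d⟫ * ⟪t₃, d⟫) +
      (‖d‖ ^ 2 * ⟪t₃, t₄⟫ - ⟪t₃, d⟫ * ⟪t₄, d⟫) + (‖d‖ ^ 2 * ⟪t₄, t₁⟫ - ⟪t₄, d⟫ * ⟪t₁, d⟫) := by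
    simp only [inner_add_left, inner_add_right]
    rw [real_inner_comm t₂ t₃, real_inner_comm t₄ t₁]
    ring
  have hpol := four_mul_form_le d (t₁ + t₃) (t₂ + t₄)
  have hup := norm_quad_sub_le hθ hV h13 h24 e₁ e₂ e₃ e₄ hd1
  have hup2 : ‖‖d‖ • (t₁ + t₃ + (t₂ + t₄)) - (2 * Real.sqrt 2) • d‖ ^ 2 ≤ (31 / 25 * ‖d‖) ^ 2 :=
    pow_le_pow_left₀ (norm_nonneg _) hup 2
  have hx1 : 1 ≤ ‖d‖ ^ 2 := by nlinarith only [hd1]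
  have hx2 : ‖d‖ ^ 2 ≤ 36 / 25 := by nlinarith only [hd1, hd2]
  nlinarith only [hB12, hB23, hB34, hB41, hsum, hpol, hup2, hx1, hx2, mul_nonneg (sub_nonneg.2 hx1) (sub_nonneg.2 hx2)]

end estimates

end Summit.AtomisticToContinuum.Crystallization.Theorems.ChargedEnergyGapChartDial

end
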